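import Summits.KontsevichZagierPeriods.KontsevichZagierPeriods.Theorems.RootDecompWalshStrataConicBands

/-!
# Conic descent 2/7: one-variable substitutions (rule 2) and the clamp trick

`lift₁`/`exists_cov₁`/`InBaker.of_cov₁`: a scalar chart `x = g(t)` on a `ℚ`-semialgebraic set `T₀`
with semialgebraic graph, derivative `g'` and injectivity transports `[r']` to `[T₀∩…, (f∘g)·|g'|]`
inside rule (2) (`KZ.changeOfVariablesRel_subset_relations`), so `InBaker` descends along it.
Rational pieces (`ratCast`, `aeval` quotients), `subRep` and rule (1b), the clamp
`κ t = max (min t 1) 0` and **`InBaker.clamp_descent`**: for semialgebraic `l ≤ u` on a 1-dim base `X`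
the weight `q·(κ u − κ l)` splits `X` into ≤ 3·3 sign pieces on which it is `0`, `q(u − l)`, `q(1 − l)`,
`q·u`, `q` — reducing «`[X, q(κu − κl)]` in the Baker sector» to the unclamped pieces; `polyRep₁`.
Imports: part 1; 0 sorry. [KontsevichZagier2001 §1.2; BCR1998 §2.2]
-/

noncomputable section

open Literature.NumberTheory.Transcendental
open MeasureTheory Set
open MvPolynomial (aeval X C)
open Literature.ModelTheory.ExponentialFields (IsSemialgebraic isSemialgebraic_univ
  isSemialgebraic_setOf_eval_pos isSemialgebraic_setOf_eval_lt isSemialgebraic_setOf_eval_le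
  isSemialgebraic_setOf_eval_nonneg isSemialgebraic_setOf_eval_eq_zero continuous_aeval_real
  tarski_seidenberg_real_holds)
open Summit.KontsevichZagierPeriods.RootDecompWalshStrata.WalshSpanProof (isSemialgebraic_cubeSet
  isBounded_cubeSet)
open Summit.KontsevichZagierPeriods.RootDecompWalshStrata.ConeSpecimen (unitIoo isSemialgebraic_unitIoo
  unitIoo_subset_Icc mem_unitIoo)

namespace Summit.KontsevichZagierPeriods.RootDecompWalshStrata.ConicDescent

/-! #### 4. One-variable substitutions (rule 2) along a scalar chart -/

/-- Lift of a scalar function to a self-map of `ℝ¹`. -/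
def lift₁ (g : ℝ → ℝ) : (Fin 1 → ℝ) → (Fin 1 → ℝ) := fun v _ => g (v 0)

/-- `lift₁ g v j = g (v 0)`. [this node] -/
@[simp] theorem lift₁_apply (g : ℝ → ℝ) (v : Fin 1 → ℝ) (j : Fin 1) : lift₁ g v j = g (v 0) := rfl

/-- The homothety `c • id` of `ℝ¹` (derivative of a lifted chart). -/
def smulId (c : ℝ) : (Fin 1 → ℝ) →L[ℝ] (Fin 1 → ℝ) := c • ContinuousLinearMap.id ℝ (Fin 1 → ℝ)

/-- `det (c • id_{ℝ¹}) = c`. [folklore] -/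
theorem smulId_det (c : ℝ) : (smulId c).det = c := by
  rw [smulId, ContinuousLinearMap.det, ContinuousLinearMap.toLinearMap_smul,
    ContinuousLinearMap.coe_id, LinearMap.det_smul, LinearMap.det_id, Module.finrank_fin_fun]
  simp

/-- A lifted chart is differentiable with derivative the homothety by `g'`. [calculus] -/
theorem hasFDerivAt_lift₁ {g : ℝ → ℝ} {g' : ℝ} {v : Fin 1 → ℝ} (h : HasDerivAt g g' (v 0)) :
    HasFDerivAt (lift₁ g) (smulId g') v := by
  refine hasFDerivAt_pi'' fun a => ?_
  have h0 : HasFDerivAt (𝕜 := ℝ) (fun y : Fin 1 → ℝ => y 0)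
      (ContinuousLinearMap.proj (R := ℝ) (φ := fun _ : Fin 1 => ℝ) 0) v :=
    hasFDerivAt_apply 0 v
  have h1 : HasFDerivAt (fun y : Fin 1 → ℝ => g (y 0))
      (g' • ContinuousLinearMap.proj (R := ℝ) (φ := fun _ : Fin 1 => ℝ) 0) v :=
    HasDerivAt.comp_hasFDerivAt (h₂ := g) v h h0
  refine h1.congr_fderiv (ContinuousLinearMap.ext fun w => ?_)
  fin_cases a
  simp [smulId, smul_eq_mul]

/-- **Rule (2) in one variable along a scalar chart.** Let `r'` be a one-dimensional
representation, `g` a `ℚ`-semialgebraic scalar chart on `T₀ ⊆ ℝ`, differentiable and injective on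
`T₀`, whose image covers `r'.domain`, and let `R` be a `ℚ`-semialgebraic function on the pulled-back
domain `T = {t ∈ T₀ | g t ∈ r'.domain}` agreeing there with `r'.integrand (g t)·|g' t|`. Then
`[T, R] − [r'] ∈ relations` for a representation with domain `T` and integrand `R` (its absolute
integrability is transported along the chart). [KontsevichZagier2001 §1.2 rule (2)] -/
theorem exists_cov₁ (r' : KZ.IntegralRep 1) {T₀ : Set (Fin 1 → ℝ)} (_hT₀ : IsSemialgebraic ℚ T₀)
    (g g' : ℝ → ℝ) (hg : IsSemialgebraicFunOn ℚ T₀ fun v => g (v 0))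
    (hder : ∀ v ∈ T₀, HasDerivAt g (g' (v 0)) (v 0))
    (hinj : ∀ s ∈ T₀, ∀ t ∈ T₀, g (s 0) = g (t 0) → s 0 = t 0)
    (hsurj : ∀ x ∈ r'.domain, ∃ v ∈ T₀, g (v 0) = x 0) (R : (Fin 1 → ℝ) → ℝ)
    (hR : IsSemialgebraicFunOn ℚ T₀ R)
    (hRe : ∀ v ∈ T₀, lift₁ g v ∈ r'.domain → R v = r'.integrand (lift₁ g v) * |g' (v 0)|) :
    ∃ r : KZ.IntegralRep 1, r.domain = {v | v ∈ T₀ ∧ lift₁ g v ∈ r'.domain} ∧ r.integrand = R ∧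
      KZ.of r - KZ.of r' ∈ KZ.relations := by
  have hT : IsSemialgebraic ℚ {v | v ∈ T₀ ∧ lift₁ g v ∈ r'.domain} := by
    have h := hg.isSemialgebraic_sep_snoc_mem tarski_seidenberg_real_holds
      (r'.isSemialgebraic_domain.preimage_comp (fun _ : Fin 1 => Fin.last 1))
    convert h using 1
    ext v
    simp only [mem_setOf_eq, mem_preimage]
    have : ((Fin.snoc v (g (v 0)) : Fin 2 → ℝ) ∘ fun _ : Fin 1 => Fin.last 1) = lift₁ g v := by
      funext j
      simp only [Function.comp_apply, Fin.snoc_last, lift₁_apply]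
    rw [this]
  have hTm : MeasurableSet {v | v ∈ T₀ ∧ lift₁ g v ∈ r'.domain} := hT.measurableSet_holds
  have hsub : {v | v ∈ T₀ ∧ lift₁ g v ∈ r'.domain} ⊆ T₀ := fun _ hv => hv.1
  have hinj' : InjOn (lift₁ g) {v | v ∈ T₀ ∧ lift₁ g v ∈ r'.domain} := by
    intro s hs t ht hst
    have h := hinj s hs.1 t ht.1 (by simpa using congrFun hst 0)
    funext j
    fin_cases j
    exact h
  have hderiv : ∀ v ∈ {v | v ∈ T₀ ∧ lift₁ g v ∈ r'.domain},
      HasFDerivWithinAt (lift₁ g) (smulId (g' (v 0))) {v | v ∈ T₀ ∧ lift₁ g v ∈ r'.domain} v :=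
    fun v hv => (hasFDerivAt_lift₁ (hder v hv.1)).hasFDerivWithinAt
  have himage : lift₁ g '' {v | v ∈ T₀ ∧ lift₁ g v ∈ r'.domain} = r'.domain := by
    ext x
    constructor
    · rintro ⟨v, hv, rfl⟩
      exact hv.2
    · intro hx
      obtain ⟨v, hv, hgv⟩ := hsurj x hx
      have hx' : lift₁ g v = x := by
        funext j
        fin_cases j
        simpa using hgv
      exact ⟨v, ⟨hv, hx' ▸ hx⟩, hx'⟩
  have hint : IntegrableOn R {v | v ∈ T₀ ∧ lift₁ g v ∈ r'.domain} volume := by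
    have h := (integrableOn_image_iff_integrableOn_abs_det_fderiv_smul (μ := volume) hTm hderiv hinj'
      r'.integrand).1 (by rw [himage]; exact r'.integrableOn)
    refine h.congr_fun (fun v hv => ?_) hTm
    change |(smulId (g' (v 0))).det| • r'.integrand (lift₁ g v) = R v
    rw [smulId_det, smul_eq_mul, hRe v hv.1 hv.2, mul_comm]
  have hR' : IsSemialgebraicFunOn ℚ {v | v ∈ T₀ ∧ lift₁ g v ∈ r'.domain} R := hR.mono hsub hT
  refine ⟨⟨{v | v ∈ T₀ ∧ lift₁ g v ∈ r'.domain}, R, hT, hR', hint⟩, rfl, rfl, ?_⟩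
  refine KZ.changeOfVariablesRel_subset_relations
    ⟨1, ⟨{v | v ∈ T₀ ∧ lift₁ g v ∈ r'.domain}, R, hT, hR', hint⟩, r', lift₁ g,
      fun v => smulId (g' (v 0)), ?_, hderiv, hinj', himage.symm, fun v hv => ?_, rfl⟩
  · exact IsSemialgebraicMapOn.of_forall hT fun j => (hg.mono hsub hT).congr fun v _ => by simp
  · change R v = r'.integrand (lift₁ g v) * |(smulId (g' (v 0))).det|
    rw [smulId_det]
    exact hRe v hv.1 hv.2

/-- `InBaker` form of `exists_cov₁`: if the pulled-back representation is RATIONAL, `[r']` lands in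
the Baker sector. [this node] -/
theorem InBaker.of_cov₁ (r' : KZ.IntegralRep 1) {T₀ : Set (Fin 1 → ℝ)} (hT₀ : IsSemialgebraic ℚ T₀)
    (g g' : ℝ → ℝ) (hg : IsSemialgebraicFunOn ℚ T₀ fun v => g (v 0))
    (hder : ∀ v ∈ T₀, HasDerivAt g (g' (v 0)) (v 0))
    (hinj : ∀ s ∈ T₀, ∀ t ∈ T₀, g (s 0) = g (t 0) → s 0 = t 0)
    (hsurj : ∀ x ∈ r'.domain, ∃ v ∈ T₀, g (v 0) = x 0) (p q : MvPolynomial (Fin 1) ℚ)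
    (hq : ∀ v ∈ T₀, aeval v q ≠ 0)
    (hRe : ∀ v ∈ T₀, lift₁ g v ∈ r'.domain →
      aeval v p / aeval v q = r'.integrand (lift₁ g v) * |g' (v 0)|) :
    InBaker (KZ.of r') := by
  obtain ⟨r, hrd, hri, hrel⟩ := exists_cov₁ r' hT₀ g g' hg hder hinj hsurj
    (fun v => aeval v p / aeval v q) (isSemialgebraicFunOn_aeval_div_aeval hT₀ p q hq) hRe
  have hrat : r.IsRational := ⟨p, q, fun v hv => hq v (by rw [hrd] at hv; exact hv.1),
    fun v _ => by rw [hri]⟩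
  refine (InBaker.of_isRational r le_rfl hrat).congr ?_
  have : KZ.of r' - KZ.of r = -(KZ.of r - KZ.of r') := by abel
  rw [this]
  exact KZ.relations.neg_mem hrel

/-! #### 5. Rational pieces, integrand additivity, clamps -/

/-- A one-dimensional representation with constant rational integrand lands in the Baker sector.
[KontsevichZagier2001 §1.1] -/
theorem InBaker.of_eqOn_ratCast (r : KZ.IntegralRep 1) (q : ℚ)
    (h : EqOn r.integrand (fun _ => (q : ℝ)) r.domain) : InBaker (KZ.of r) :=
  InBaker.of_isRational r le_rfl ⟨MvPolynomial.C q, 1, fun _ _ => by simp, fun x hx => by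
    simp [h hx]⟩

/-- A one-dimensional representation with a rational-function integrand `p/q` lands in the Baker
sector. [KontsevichZagier2001 §1.1] -/
theorem InBaker.of_eqOn_aeval_div (r : KZ.IntegralRep 1) (p q : MvPolynomial (Fin 1) ℚ)
    (hq : ∀ v ∈ r.domain, aeval v q ≠ 0)
    (h : EqOn r.integrand (fun v => aeval v p / aeval v q) r.domain) : InBaker (KZ.of r) :=
  InBaker.of_isRational r le_rfl ⟨p, q, hq, h⟩

/-- A one-dimensional representation with a polynomial integrand lands in the Baker sector.
[KontsevichZagier2001 §1.1] -/
theorem InBaker.of_eqOn_aeval (r : KZ.IntegralRep 1) (p : MvPolynomial (Fin 1) ℚ)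
    (h : EqOn r.integrand (fun v => aeval v p) r.domain) : InBaker (KZ.of r) :=
  InBaker.of_eqOn_aeval_div r p 1 (fun _ _ => by simp) fun v hv => by simp [h hv]

/-- The difference representation `[σ, f − f₁]` of two representations on the same domain. -/
def subRep {N : ℕ} (r r₁ : KZ.IntegralRep N) (h : r₁.domain = r.domain) : KZ.IntegralRep N where
  domain := r.domain
  integrand x := r.integrand x - r₁.integrand x
  isSemialgebraic_domain := r.isSemialgebraic_domain
  isSemialgebraicFunOn_integrand :=
    IsSemialgebraicFunOn.sub_holds r.isSemialgebraicFunOn_integrand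
      (by rw [← h]; exact r₁.isSemialgebraicFunOn_integrand)
  integrableOn := r.integrableOn.sub (by rw [← h]; exact r₁.integrableOn)

/-- The domain of `subRep r r₁ h` is `r.domain`. [this node] -/
@[simp] theorem subRep_domain {N : ℕ} (r r₁ : KZ.IntegralRep N) (h : r₁.domain = r.domain) :
    (subRep r r₁ h).domain = r.domain := rfl

/-- The integrand of `subRep r r₁ h` is the difference of the integrands. [this node] -/
@[simp] theorem subRep_integrand {N : ℕ} (r r₁ : KZ.IntegralRep N) (h : r₁.domain = r.domain)
    (x : Fin N → ℝ) : (subRep r r₁ h).integrand x = r.integrand x - r₁.integrand x := rfl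

/-- Rule (1b): `[σ, f] − [σ, f₁] − [σ, f − f₁] ∈ relations`. [KontsevichZagier2001 §1.2 rule (1)] -/
theorem of_sub_sub_subRep_mem_relations {N : ℕ} (r r₁ : KZ.IntegralRep N)
    (h : r₁.domain = r.domain) : KZ.of r - KZ.of r₁ - KZ.of (subRep r r₁ h) ∈ KZ.relations :=
  KZ.integrandAddRel_subset_relations ⟨N, r, r₁, subRep r r₁ h, h, rfl, fun x _ => by
    simp only [Pi.add_apply, subRep_integrand]; ring, rfl⟩

/-- `InBaker [σ, f]` follows from `InBaker [σ, f₁]` and `InBaker [σ, f − f₁]`. [this node] -/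
theorem InBaker.of_sub' {N : ℕ} (r r₁ : KZ.IntegralRep N) (h : r₁.domain = r.domain)
    (h₁ : InBaker (KZ.of r₁)) (h₂ : InBaker (KZ.of (subRep r r₁ h))) : InBaker (KZ.of r) := by
  refine (h₁.add h₂).congr ?_
  have := of_sub_sub_subRep_mem_relations r r₁ h
  rwa [sub_sub] at this

/-- The clamp `κ t = max (min t 1) 0` of `ℝ` onto `[0, 1]`. -/
def clamp (t : ℝ) : ℝ := max (min t 1) 0

/-- `0 ≤ κ t`. [folklore] -/
theorem clamp_nonneg (t : ℝ) : 0 ≤ clamp t := le_max_right _ _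

/-- `κ t ≤ 1`. [folklore] -/
theorem clamp_le_one (t : ℝ) : clamp t ≤ 1 := max_le (min_le_right _ _) zero_le_one

/-- `κ t = 0` for `t ≤ 0`. [folklore] -/
theorem clamp_of_nonpos {t : ℝ} (h : t ≤ 0) : clamp t = 0 :=
  max_eq_right ((min_le_left _ _).trans h)

/-- `κ t = 1` for `1 ≤ t`. [folklore] -/
theorem clamp_of_one_le {t : ℝ} (h : 1 ≤ t) : clamp t = 1 := by
  rw [clamp, min_eq_right h, max_eq_left (zero_le_one' ℝ)]

/-- `κ t = t` for `t ∈ [0,1]`. [folklore] -/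
theorem clamp_of_mem {t : ℝ} (h0 : 0 ≤ t) (h1 : t ≤ 1) : clamp t = t := by
  rw [clamp, min_eq_left h1, max_eq_left h0]

/-- `κ` is monotone. [folklore] -/
theorem clamp_mono {a b : ℝ} (h : a ≤ b) : clamp a ≤ clamp b :=
  max_le_max (min_le_min_right 1 h) le_rfl

/-- For `0 < y < 1`: `κ t < y ↔ t < y`. [folklore] -/
theorem clamp_lt_iff {t y : ℝ} (hy0 : 0 < y) (hy1 : y < 1) : clamp t < y ↔ t < y := by
  rcases le_total t 0 with h | h
  · rw [clamp_of_nonpos h]; constructor <;> intro <;> linarith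
  rcases le_total 1 t with h' | h'
  · rw [clamp_of_one_le h']; constructor <;> intro <;> linarith
  · rw [clamp_of_mem h h']

/-- For `0 < y < 1`: `y < κ t ↔ y < t`. [folklore] -/
theorem lt_clamp_iff {t y : ℝ} (hy0 : 0 < y) (hy1 : y < 1) : y < clamp t ↔ y < t := by
  rcases le_total t 0 with h | h
  · rw [clamp_of_nonpos h]; constructor <;> intro <;> linarith
  rcases le_total 1 t with h' | h'
  · rw [clamp_of_one_le h']; constructor <;> intro <;> linarith
  · rw [clamp_of_mem h h']

/-- `κ t = ((t + 1 − |t − 1|)/2 + |(t + 1 − |t − 1|)/2|)/2` (`min`/`max` through `|·|`). [folklore] -/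
theorem clamp_eq_abs (t : ℝ) : clamp t = ((t + 1 - |t - 1|) / 2 + |(t + 1 - |t - 1|) / 2|) / 2 := by
  have hmin : min t 1 = (t + 1 - |t - 1|) / 2 := by
    rcases le_total t 1 with h | h
    · rw [min_eq_left h, abs_of_nonpos (by linarith)]; ring
    · rw [min_eq_right h, abs_of_nonneg (by linarith)]; ring
  have hmax : ∀ u : ℝ, max u 0 = (u + |u|) / 2 := fun u => by
    rcases le_total u 0 with h | h
    · rw [max_eq_right h, abs_of_nonpos h]; ring
    · rw [max_eq_left h, abs_of_nonneg h]; ring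
  rw [clamp, hmax, hmin]

/-- The clamp of a semialgebraic function is semialgebraic. [BCR1998 Prop. 2.2.6] -/
theorem IsSemialgebraicFunOn.clamp {N : ℕ} {X : Set (Fin N → ℝ)} {w : (Fin N → ℝ) → ℝ}
    (hX : IsSemialgebraic ℚ X) (hw : IsSemialgebraicFunOn ℚ X w) :
    IsSemialgebraicFunOn ℚ X fun v => clamp (w v) := by
  have h1 : IsSemialgebraicFunOn ℚ X fun v => (w v + 1 - |w v - 1|) / 2 := by
    have ha : IsSemialgebraicFunOn ℚ X fun v => |w v - 1| :=
      (IsSemialgebraicFunOn.sub_holds hw (isSemialgebraicFunOn_ratCast hX 1)).abs.congr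
        fun v _ => by push_cast; rfl
    exact (IsSemialgebraicFunOn.mul_holds (isSemialgebraicFunOn_ratCast hX (1 / 2))
      (IsSemialgebraicFunOn.sub_holds (IsSemialgebraicFunOn.add_holds hw
        (isSemialgebraicFunOn_ratCast hX 1)) ha)).congr fun v _ => by
          simp only [Pi.mul_apply, Pi.sub_apply, Pi.add_apply]; push_cast; ring
  have h2 : IsSemialgebraicFunOn ℚ X fun v => ((w v + 1 - |w v - 1|) / 2 + |(w v + 1 - |w v - 1|) / 2|) / 2 :=
    (IsSemialgebraicFunOn.mul_holds (isSemialgebraicFunOn_ratCast hX (1 / 2))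
      (IsSemialgebraicFunOn.add_holds h1 h1.abs)).congr fun v _ => by
        simp only [Pi.mul_apply, Pi.add_apply]; push_cast; ring
  exact h2.congr fun v _ => (clamp_eq_abs (w v)).symm

/-- **Clamp descent.** Let `w` be semialgebraic on `X ⊆ [0,1]`. If `[X ∩ {0 ≤ w ≤ 1}, q·w]` lands
in the Baker sector then so does `[X, q·κ(w)]`: on `{w < 0}` the integrand vanishes and on
`{w > 1}` it is the rational constant `q` (rule (1a)). [this node] -/
theorem InBaker.clamp_descent {X : Set (Fin 1 → ℝ)} (hXs : IsSemialgebraic ℚ X)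
    {w : (Fin 1 → ℝ) → ℝ} (hw : IsSemialgebraicFunOn ℚ X w) (q : ℚ)
    (h : ∀ r₁ : KZ.IntegralRep 1, r₁.domain = {v | v ∈ X ∧ 0 ≤ w v ∧ w v ≤ 1} →
      EqOn r₁.integrand (fun v => (q : ℝ) * w v) r₁.domain → InBaker (KZ.of r₁))
    (r : KZ.IntegralRep 1) (hr : r.domain = X)
    (hri : EqOn r.integrand (fun v => (q : ℝ) * clamp (w v)) r.domain) : InBaker (KZ.of r) := by
  have hA : IsSemialgebraic ℚ {v | v ∈ X ∧ 0 ≤ w v} := hw.isSemialgebraic_sep_nonneg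
  have hAr : {v | v ∈ X ∧ 0 ≤ w v} ⊆ r.domain := fun v hv => hr ▸ hv.1
  refine InBaker.of_restrict_of_eqOn_zero r hA hAr (fun v hv hvA => ?_) ?_
  · rw [hri hv]
    have hw0 : w v < 0 := by
      by_contra hcon
      exact hvA ⟨hr ▸ hv, not_lt.mp hcon⟩
    simp [clamp_of_nonpos hw0.le]
  have h2 : IsSemialgebraic ℚ {v | v ∈ X ∧ 0 ≤ w v ∧ w v ≤ 1} := by
    have hw' : IsSemialgebraicFunOn ℚ {v | v ∈ X ∧ 0 ≤ w v} fun v => 1 - w v :=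
      (IsSemialgebraicFunOn.sub_holds (isSemialgebraicFunOn_ratCast hA 1)
        (hw.mono (fun _ hv => hv.1) hA)).congr fun v _ => by push_cast; rfl
    convert hw'.isSemialgebraic_sep_nonneg using 1
    ext v
    simp only [mem_setOf_eq]
    constructor
    · rintro ⟨hv, h0, h1⟩
      exact ⟨⟨hv, h0⟩, by linarith⟩
    · rintro ⟨⟨hv, h0⟩, h1⟩
      exact ⟨hv, h0, by linarith⟩
  have h3 : IsSemialgebraic ℚ {v | v ∈ X ∧ 1 < w v} := by
    have hw' : IsSemialgebraicFunOn ℚ X fun v => 1 - w v :=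
      (IsSemialgebraicFunOn.sub_holds (isSemialgebraicFunOn_ratCast hXs 1) hw).congr
        fun v _ => by push_cast; rfl
    convert hw'.isSemialgebraic_sep_neg using 1
    ext v
    simp only [mem_setOf_eq]
    constructor
    · rintro ⟨hv, h1⟩
      exact ⟨hv, by linarith⟩
    · rintro ⟨hv, h1⟩
      exact ⟨hv, by linarith⟩
  refine InBaker.of_split (r.restrict _ hA hAr) h2 h3 (fun v hv => ⟨hv.1, hv.2.1⟩)
    (fun v hv => ⟨hv.1, hv.2.le.trans' zero_le_one⟩) ?_ ?_ ?_ ?_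
  · ext v
    simp only [KZ.IntegralRep.domain_restrict, mem_setOf_eq, mem_union]
    constructor
    · rintro ⟨hv, h0⟩
      rcases le_or_gt (w v) 1 with h1 | h1
      · exact Or.inl ⟨hv, h0, h1⟩
      · exact Or.inr ⟨hv, h1⟩
    · rintro (⟨hv, h0, _⟩ | ⟨hv, h1⟩)
      · exact ⟨hv, h0⟩
      · exact ⟨hv, zero_le_one.trans h1.le⟩
  · have : {v | v ∈ X ∧ 0 ≤ w v ∧ w v ≤ 1} ∩ {v | v ∈ X ∧ 1 < w v} = ∅ := by
      ext v
      simp only [mem_inter_iff, mem_setOf_eq, mem_empty_iff_false, iff_false, not_and, not_lt]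
      intro h _
      exact h.2.2
    rw [this, measure_empty]
  · refine h _ rfl fun v hv => ?_
    simp only [KZ.IntegralRep.domain_restrict, mem_setOf_eq] at hv
    simp only [KZ.IntegralRep.integrand_restrict]
    rw [hri (hr ▸ hv.1 : v ∈ r.domain)]
    simp only [clamp_of_mem hv.2.1 hv.2.2]
  · refine InBaker.of_eqOn_ratCast _ q fun v hv => ?_
    simp only [KZ.IntegralRep.domain_restrict, mem_setOf_eq] at hv
    simp only [KZ.IntegralRep.integrand_restrict]
    rw [hri (hr ▸ hv.1 : v ∈ r.domain)]
    simp only [clamp_of_one_le hv.2.le, mul_one]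

/-- The subset of `s` where a semialgebraic function is positive is semialgebraic.
[BCR1998 §2.2] -/
theorem IsSemialgebraicFunOn.isSemialgebraic_sep_pos {N : ℕ} {s : Set (Fin N → ℝ)}
    {f : (Fin N → ℝ) → ℝ} (hf : IsSemialgebraicFunOn ℚ s f) :
    IsSemialgebraic ℚ {x | x ∈ s ∧ 0 < f x} := by
  convert hf.neg.isSemialgebraic_sep_neg using 1
  ext x
  simp

/-- The polynomial representation `[s, p]` on a subset of the unit cube. [KontsevichZagier2001 §1.1] -/
def polyRep₁ {N : ℕ} (s : Set (Fin N → ℝ)) (hs : IsSemialgebraic ℚ s) (hsI : s ⊆ Icc 0 1)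
    (p : MvPolynomial (Fin N) ℚ) : KZ.IntegralRep N where
  domain := s
  integrand v := aeval v p
  isSemialgebraic_domain := hs
  isSemialgebraicFunOn_integrand := isSemialgebraicFunOn_aeval hs p
  integrableOn :=
    ((continuous_aeval_of_algebra p).continuousOn.integrableOn_compact isCompact_Icc).mono_set hsI

/-- The domain of `polyRep₁` is the given set. [this node] -/
@[simp] theorem polyRep₁_domain {N : ℕ} (s : Set (Fin N → ℝ)) (hs : IsSemialgebraic ℚ s)
    (hsI : s ⊆ Icc 0 1) (p : MvPolynomial (Fin N) ℚ) : (polyRep₁ s hs hsI p).domain = s := rfl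

/-- The integrand of `polyRep₁` is the polynomial function. [this node] -/
@[simp] theorem polyRep₁_integrand {N : ℕ} (s : Set (Fin N → ℝ)) (hs : IsSemialgebraic ℚ s)
    (hsI : s ⊆ Icc 0 1) (p : MvPolynomial (Fin N) ℚ) (v : Fin N → ℝ) :
    (polyRep₁ s hs hsI p).integrand v = aeval v p := rfl

end Summit.KontsevichZagierPeriods.RootDecompWalshStrata.ConicDescent

end
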